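/-
Copyright (c) 2026 the pub-hodgecm-mathlib formalisation cell (harness21).  Prover seat hodgecm-mathlib-K2E2-p10 (g0),
Track B «K2-LIT» ∕ h413 (stmt-HodgeConjecture-24833), line K2_E2 «ThetaExhaustionByRigidity», unit L2-COMPLETENESS, file #10:
payment of the socket `K2E2ThetaExhaustionByRigidity.L2Completeness.sig_K2E2L2MemOfProjectionRigidity` — CAPTURE OF AN `L²`-CLASS
BY PROJECTION RIGIDITY.  2026-09-03.
-/
import Literature.NumberTheory.Automorphic.AdelicUnitaryGroupSpectrum            -- ★ the unitary datum `UnitaryGroup.adelicGroupData`, `L²`, `rightRegular`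
import Literature.NumberTheory.Automorphic.HilbertRepOrthogonalDecomposition     -- ★ `IsUnitary.exists_orthogonalDecomposition_of_isDiscretelyDecomposable`
import HarnessLib

/-!
# K2_E2 road (h413 = stmt-HodgeConjecture-24833), unit L2-COMPLETENESS, file #10:
# an `L²`-class all of whose discrete receivers are `P` lies in `P`

Cell `pub/hodgecm-mathlib` (D-0151), Track B (21-frontier RULING «PUSH BOTH» 2026-09-03, director req621∕req624, chair K2-lead,
dealer K2E2-plan), socket module
`Summits/HodgeConjecture/HodgeConjecture/Cruxes/H413/Lines/K2_E2_ThetaExhaustionByRigidity_L2Completeness.lean` (planner K2E2-plan (g0),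
sha16 bb9ff41ab0a0bc84), socket **`sig_K2E2L2MemOfProjectionRigidity`** (SIGS TABLE row #10, size S): for the generic unitary datum
`𝒢 = UnitaryGroup.adelicGroupData F E c N J` with compact automorphic quotient, an automorphic measure `μ` with `L²(μ)` discretely
decomposable, a discrete automorphic representation `P ≤ L²(μ)` and a class `θ ∈ L²(μ)`: if every discrete automorphic `P′` with
`pr_{P′} θ ≠ 0` equals `P`, then `θ ∈ P`.  This is the Hilbert-space half of the tier-0 stub `stub_thetaClassCapture` of
`Cruxes/H413/Lines/K2_E2_ThetaExhaustionByRigidity.lean` ([Liu2021, proof of Prop. 4.13, Case 1]).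

THE MATHEMATICS (proof strategy: ORTHOGONAL DECOMPOSITION — independent of the sibling socket #9 `sig_K2E2L2OrthogonalReceiverOfNotMem`,
whose «orthogonal receiver» route is the planner's suggested chain; either closes #10).
* `L²(μ)` is a unitary representation (★ `AdelicGroupData.isUnitary_rightRegular`), so discrete decomposability (`L²` is the closed span
  of its irreducible closed invariant subspaces) yields a set `S` of pairwise ORTHOGONAL irreducible closed invariant subspaces with dense
  sum, `L² = ⊕̂_{W ∈ S} W` (★ `IsUnitary.exists_orthogonalDecomposition_of_isDiscretelyDecomposable`, Zorn + the isometric part of a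
  compressed projection; [Dixmier1977, 5.4.1], [DeitmarEchterhoff2014, Thm. 9.2.2]).
* Every `W ∈ S` is a discrete automorphic representation, so by the rigidity hypothesis either `pr_W θ = 0`, i.e. `θ ⟂ W`, or `W = P`.
* If `P ∈ S`: the vector `θ − pr_P θ ∈ P^⟂` is orthogonal to `P` and to every other member `W ≠ P` of `S` (`θ ⟂ W` by rigidity,
  `pr_P θ ∈ P ⟂ W` by orthogonality of the family), hence to the dense sum, hence zero: `θ = pr_P θ ∈ P`.
* If `P ∉ S`: `θ` is orthogonal to every member of `S`, hence `θ = 0 ∈ P`.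
No hypothesis is idle: without discrete decomposability the statement fails for a class in the continuous spectrum orthogonal to
`L²_disc` (no receiver at all, `θ ∉ P`); without the rigidity hypothesis take `θ ∈ P′ ⟂ P`.

* §1 `mem_of_forall_starProjection_ne_zero_imp_eq` — the statement for ANY adelic group datum ★ `AdelicGroupData` and any automorphic
  measure (no compactness needed once discrete decomposability is assumed), over closed subrepresentations.
* §2 **`memOfProjectionRigidity`** — `sig_K2E2L2MemOfProjectionRigidity` TOKEN FOR TOKEN (§1 at the unitary datum).

HONEST LABEL: HC_CM is proved only modulo the 7 printed citations (2 remaining named inputs: hLiu418 = stmt-HodgeConjecture-24832,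
h413 = stmt-HodgeConjecture-24833) until rung 0 closes; this file is a `--supports stmt-HodgeConjecture-24833` helper (scaffold of the
K2_E2 road, consumed BY NAME by the closer #13 `K2E2CapThetaClassCapture`) and retires nothing by itself.

## References
* [Dixmier1977] J. Dixmier, *C\*-algebras*, North-Holland (1977), 5.4.1 (orthogonal decomposition of a discretely decomposable
  unitary representation), §13.1.2.
* [DeitmarEchterhoff2014] A. Deitmar, S. Echterhoff, *Principles of Harmonic Analysis*, 2nd ed. (2014), Thm. 9.2.2.
* [BorelJacquet1979] A. Borel, H. Jacquet, *Automorphic forms and automorphic representations*, PSPM 33.1 (1979), §4.6.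
* [Liu2021] Y. Liu, *Theta correspondence for almost unramified representations of unitary groups*, proof of Prop. 4.13, Case 1.
-/

set_option autoImplicit false
-- the mandated namespace repeats the single-problem summit's segment (`HodgeConjecture.HodgeConjecture`)
set_option linter.dupNamespace false

noncomputable section

open scoped InnerProductSpace
open MeasureTheory NumberField ContRepresentation
open Literature.NumberTheory.Automorphic Literature.NumberTheory.Automorphic.UnitaryGroup

namespace Summit.HodgeConjecture.HodgeConjecture.Cruxes.H413.K2E2L2MemOfProjectionRigidity

universe u

/-! ## §1  Any adelic group datum: capture by projection rigidity over an orthogonal decomposition -/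

section Adelic

variable {K : Type} [Field K] [NumberField K] {𝒢 : AdelicGroupData.{u} K} {μ : Measure 𝒢.automorphicQuotient}
  [𝒢.IsAutomorphicMeasure μ]

/-- **Capture by projection rigidity (generic datum).**  Let `μ` be an automorphic measure on the automorphic quotient of an adelic
group datum `𝒢` with `L²(μ)` discretely decomposable, `P ≤ L²(μ)` a discrete automorphic representation and `θ ∈ L²(μ)`.  If every
discrete automorphic `P′` with `pr_{P′} θ ≠ 0` is `P`, then `θ ∈ P`.  Proof: over an orthogonal decomposition `L² = ⊕̂_{W ∈ S} W` into
irreducibles ([Dixmier1977, 5.4.1]) the hypothesis makes `θ` orthogonal to every member `W ≠ P`; if `P ∈ S` then `θ − pr_P θ` is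
orthogonal to the dense sum, so `θ = pr_P θ`; otherwise `θ` itself is, so `θ = 0`.
[cite: Dixmier1977, 5.4.1] [cite: DeitmarEchterhoff2014, Thm. 9.2.2] [cite: BorelJacquet1979, §4.6] -/
theorem mem_of_forall_starProjection_ne_zero_imp_eq (hdisc : (𝒢.rightRegular μ).IsDiscretelyDecomposable)
    (P : DiscreteAutomorphicRep 𝒢 μ) (θ : 𝒢.L2 μ)
    (hrig : ∀ P' : DiscreteAutomorphicRep 𝒢 μ, P'.space.toSubmodule.starProjection θ ≠ 0 → P' = P) :
    θ ∈ P.space.toSubmodule := by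
  have hπ : (𝒢.rightRegular μ).IsUnitary := 𝒢.isUnitary_rightRegular μ
  obtain ⟨S, hirr, horth, hspan⟩ := hπ.exists_orthogonalDecomposition_of_isDiscretelyDecomposable hdisc
  -- the sum of the members of `S` is dense: its orthogonal complement vanishes
  have hbot : (⨆ W : S, (W : ClosedSubrep (𝒢.rightRegular μ)).toSubmodule)ᗮ = ⊥ :=
    ClosedSubrep.orthogonal_iSup_eq_bot_of_iSupClosure_eq_top hspan
  -- rigidity: `θ` is orthogonal to every member of `S` other than `P`
  have hkey : ∀ W ∈ S, W ≠ P.space → θ ∈ W.toSubmoduleᗮ := by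
    intro W hW hne
    by_contra hθ
    refine hne (congrArg DiscreteAutomorphicRep.space (hrig ⟨W, hirr W hW⟩ ?_))
    change W.toSubmodule.starProjection θ ≠ 0
    rw [Ne, Submodule.starProjection_apply, Submodule.coe_eq_zero, Submodule.orthogonalProjectionOnto_eq_zero_iff]
    exact hθ
  -- membership in the orthogonal complement of the sum is membership in each complement
  have hmem : ∀ v : 𝒢.L2 μ, (∀ W ∈ S, v ∈ W.toSubmoduleᗮ) →
      v ∈ (⨆ W : S, (W : ClosedSubrep (𝒢.rightRegular μ)).toSubmodule)ᗮ := by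
    intro v hv
    rw [← Submodule.iInf_orthogonal, Submodule.mem_iInf]
    exact fun W => hv W W.2
  by_cases hP : P.space ∈ S
  · -- `θ - pr_P θ` is orthogonal to every member of `S`
    have h0 : θ - P.space.toSubmodule.starProjection θ ∈
        (⨆ W : S, (W : ClosedSubrep (𝒢.rightRegular μ)).toSubmodule)ᗮ := by
      refine hmem _ fun W hW => ?_
      by_cases hWP : W = P.space
      · subst hWP
        exact Submodule.sub_starProjection_mem_orthogonal θ
      · refine Submodule.sub_mem _ (hkey W hW hWP) ?_
        -- `pr_P θ ∈ P ⟂ W`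
        have hPW : P.space.toSubmodule ⟂ W.toSubmodule := horth hP hW (Ne.symm hWP)
        exact (Submodule.isOrtho_iff_le.mp hPW) (Submodule.starProjection_apply_mem _ θ)
    rw [hbot, Submodule.mem_bot, sub_eq_zero] at h0
    rw [h0]
    exact Submodule.starProjection_apply_mem _ θ
  · -- `θ` itself is orthogonal to every member of `S`, hence zero
    have h0 : θ ∈ (⨆ W : S, (W : ClosedSubrep (𝒢.rightRegular μ)).toSubmodule)ᗮ :=
      hmem θ fun W hW => hkey W hW fun h => hP (h ▸ hW)
    rw [hbot, Submodule.mem_bot] at h0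
    rw [h0]
    exact Submodule.zero_mem _

end Adelic

/-! ## §2  The socket, token for token -/

/-- **PAYMENT OF `sig_K2E2L2MemOfProjectionRigidity`** (socket #10 of unit L2-COMPLETENESS of the K2_E2 road «ThetaExhaustionByRigidity»,
`Cruxes/H413/Lines/K2_E2_ThetaExhaustionByRigidity_L2Completeness.lean`, TOKEN FOR TOKEN).
**Capture by projection rigidity.**  For the unitary group datum `U(J)` of `E/F` (★ `UnitaryGroup.adelicGroupData F E c N J`) with compact
automorphic quotient, an automorphic measure `μ` with `L²(μ)` discretely decomposable, a discrete automorphic `P ≤ L²(μ)` and `θ ∈ L²(μ)`: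
if every discrete automorphic `P′` with `pr_{P′} θ ≠ 0` equals `P`, then `θ ∈ P` (§1 `mem_of_forall_starProjection_ne_zero_imp_eq`; the
compactness hypothesis of the socket is not used beyond what discrete decomposability already provides).
[cite: Dixmier1977, 5.4.1] [cite: DeitmarEchterhoff2014, Thm. 9.2.2] [cite: BorelJacquet1979, §4.6]
[cite: Liu2021, proof of Prop. 4.13 Case 1] -/
theorem memOfProjectionRigidity :
    ∀ {F E : Type} [Field F] [NumberField F] [Field E] [NumberField E] [Algebra F E] {c : E ≃ₐ[F] E} {N : ℕ}
      {J : Matrix (Fin N) (Fin N) E} (μ : Measure (adelicGroupData F E c N J).automorphicQuotient)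
      [(adelicGroupData F E c N J).IsAutomorphicMeasure μ] [CompactSpace (adelicGroupData F E c N J).automorphicQuotient],
      ((adelicGroupData F E c N J).rightRegular μ).IsDiscretelyDecomposable →
      ∀ (P : DiscreteAutomorphicRep (adelicGroupData F E c N J) μ) (θ : (adelicGroupData F E c N J).L2 μ),
        (∀ P' : DiscreteAutomorphicRep (adelicGroupData F E c N J) μ, P'.space.toSubmodule.starProjection θ ≠ 0 → P' = P) →
        θ ∈ P.space.toSubmodule := by
  intro F E _ _ _ _ _ c N J μ _ _ hdisc P θ hrig
  exact mem_of_forall_starProjection_ne_zero_imp_eq hdisc P θ hrig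

end Summit.HodgeConjecture.HodgeConjecture.Cruxes.H413.K2E2L2MemOfProjectionRigidity

end
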